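import Summits.ValiantsHypothesis.ValiantsHypothesis.Theorems.BinomialElusivePeelingLemmaGadgetDefs

/-!
# Route `BinomialElusive`, crux `PeelingLemma` (stmt-ValiantsHypothesis-7391) — vocabulary of the
negative lane, part 4: the theta gadget with BLOCK age orders (route-posited object, D-0016)

Blueprint `Cruxes/PeelingLemma/DETERMINISTIC-ALLX.md` §3e (module [T3]).  The branch-region local
lemma fails for the first two gadget designs (`armAge` = one transposition, with the closing orders
`closing` / `closing2`) because a letter of `b` may be OLD on two arms at once (explicit cost-6
two-slot configurations, blueprint §3c/§3e).  Requirement §3e: the `R+1` oldest letters of `b` on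
arm `j`, and the `R+1` youngest letters of `b'` on arm `j` (the kept letter and the last `R` closing
births), form ARM-SPECIFIC blocks.  This file realises it with the simplest parity-preserving
involution of the index set `Fin (2q+1)`: arm `j` exchanges the top block `[2q-R, 2q]` with the
block `[2q-d_j-R, 2q-d_j]`, `d_j = (2R+2)·j` (`blockShift`), and uses the SAME involution for the
closing births at `b'` (`birthNat3`: the letter `beta' (blockAge a)` is born `a` steps after the
first closing birth, the kept letter being `a = 2q`).  Meaningful for `9R+8 ≤ 2q`; below that
threshold `blockAge` is the identity (so that it is a permutation unconditionally).  Lemmas in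
`BinomialElusivePeelingLemmaGadgetBlock.lean`; validated numerically (gadget_perm.py, kit job
j290895: no local-lemma violation of cost ≤ 8 near `b`/`b'`, where the earlier designs fail at
cost 6).  Nothing here asserts anything beyond the two arithmetic facts needed to build the
permutation.
-/

-- `Summit.ValiantsHypothesis.ValiantsHypothesis.…` is the tree's mandated single-conjunct layout
-- (Sub = Summit), so the duplicated namespace component is intended.
set_option linter.dupNamespace false

namespace Summit.ValiantsHypothesis.ValiantsHypothesis.Theorems.PeelingLemmaGadget

/-- The shift of arm `j`'s block: `d_j = (2R+2)·j` (even, and distinct arms' shifts differ by at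
least `2R+2`, so the blocks `[2q-d_j-R, 2q-d_j]` are pairwise disjoint). -/
def blockShift (R : ℕ) (j : Fin 5) : ℕ := (2 * R + 2) * (j : ℕ)

/-- The block involution on indices: exchange `[2q-R, 2q]` with `[2q-d-R, 2q-d]`, fix the rest
(for admissible `d`, i.e. `d = 0` or `R+1 ≤ d ≤ 2q-R`). -/
def blockSwapNat (q R d a : ℕ) : ℕ :=
  if 2 * q - R ≤ a then a - d else if 2 * q - d - R ≤ a ∧ a + d ≤ 2 * q then a + d else a

/-- `blockSwapNat` stays below `2q+1`. -/
theorem blockSwapNat_lt (q R d : ℕ) {a : ℕ} (ha : a < 2 * q + 1) : blockSwapNat q R d a < 2 * q + 1 := by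
  unfold blockSwapNat; split_ifs <;> omega

/-- `blockSwapNat` is an involution when the two blocks are equal (`d = 0`) or disjoint
(`R+1 ≤ d`) and fit below `2q`. -/
theorem blockSwapNat_blockSwapNat (q R d : ℕ) (hd : d = 0 ∨ R + 1 ≤ d) (hq : d + R ≤ 2 * q) {a : ℕ}
    (ha : a < 2 * q + 1) : blockSwapNat q R d (blockSwapNat q R d a) = a := by
  unfold blockSwapNat; split_ifs <;> omega

/-- The block involution as a permutation of `Fin (2q+1)`, for admissible `d`. -/
def blockPerm (q R d : ℕ) (hd : d = 0 ∨ R + 1 ≤ d) (hq : d + R ≤ 2 * q) :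
    Equiv.Perm (Fin (2 * q + 1)) :=
  Function.Involutive.toPerm (fun a => ⟨blockSwapNat q R d a, blockSwapNat_lt q R d a.isLt⟩)
    (fun a => Fin.ext (blockSwapNat_blockSwapNat q R d hd hq a.isLt))

/-- `blockShift R j` is `0` or at least `2R+2`. -/
theorem blockShift_eq_zero_or_le (R : ℕ) (j : Fin 5) :
    blockShift R j = 0 ∨ R + 1 ≤ blockShift R j := by
  unfold blockShift
  rcases Nat.eq_zero_or_pos (j : ℕ) with h | h
  · exact Or.inl (by rw [h, Nat.mul_zero])
  · exact Or.inr (le_trans (by omega) (Nat.le_mul_of_pos_right _ h))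

/-- `blockShift R j ≤ 8R+8`. -/
theorem blockShift_le (R : ℕ) (j : Fin 5) : blockShift R j ≤ 8 * R + 8 := by
  unfold blockShift
  calc (2 * R + 2) * (j : ℕ) ≤ (2 * R + 2) * 4 := Nat.mul_le_mul_left _ (by have := j.isLt; omega)
    _ = 8 * R + 8 := by ring

/-- **Arm `j`'s age order at `b` / closing order at `b'` (block design).**  The block involution with
shift `blockShift R j` when `9R+8 ≤ 2q`, the identity otherwise. -/
def blockAge (q R : ℕ) (j : Fin 5) : Equiv.Perm (Fin (2 * q + 1)) :=
  if h : 9 * R + 8 ≤ 2 * q then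
    blockPerm q R (blockShift R j) (blockShift_eq_zero_or_le R j)
      (by have := blockShift_le R j; omega)
  else Equiv.refl _

/-- The birth sequence of arm `j` of the block gadget on natural positions: `beta (blockAge (2q-n))`
at `n ≤ 2q` (so `blockAge` maps ages at `b` to letters), ordinary births at `2q+1..2q+no`, `ex j` at
`2q+no+1`, then the letters of `b'` in the order `beta' (blockAge 0), …, beta' (blockAge (2q))` at
`2q+no+2 .. 4q+no+2` (the last one, born at `b' = 4q+no+2`, is the kept letter), junk beyond. -/
def birthNat3 (q R no : ℕ) (j : Fin 5) (n : ℕ) : GLetter q no :=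
  if h₁ : n ≤ 2 * q then GLetter.beta (blockAge q R j ⟨2 * q - n, by omega⟩)
  else if h₂ : n ≤ 2 * q + no then GLetter.ord j ⟨n - (2 * q + 1), by omega⟩
  else if n = 2 * q + no + 1 then GLetter.ex j
  else if h₄ : n ≤ 4 * q + no + 2 then GLetter.beta' (blockAge q R j ⟨n - (2 * q + no + 2), by omega⟩)
  else GLetter.junk n

/-- The birth sequence of arm `j` of the block gadget as a function on `ℤ` (junk at negative positions). -/
def birth3 (q R no : ℕ) (j : Fin 5) (t : ℤ) : GLetter q no :=
  if t < 0 then GLetter.junk t else birthNat3 q R no j t.toNat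

end Summit.ValiantsHypothesis.ValiantsHypothesis.Theorems.PeelingLemmaGadget
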